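import Summits.BirchSwinnertonDyer.BirchSwinnertonDyer.Theorems.KolyvaginRankRigidityAtTwoSwapKummerEigenLinesAtTwo
import Summits.BirchSwinnertonDyer.BirchSwinnertonDyer.Theorems.GenusKolyvaginAtTwoPowDvdShaCardAtTwoPosTRegularEigenCyclic
import HarnessLib

/-!
# Crux U1 `KolyvaginBoundedDefectAtTwo` (stmt-BirchSwinnertonDyer-28083), LINE 17 `regular_core_rigidity` v3,
# stub S1b `stub_nearCoreExistenceAtTwo` — (N2) REGULAR EIGEN-LINES: at a REGULAR Kolyvagin prime every
# Frobenius is a regular involution on `E[2^k]`; the `±`-eigen-lines of `σ_{*,λ}` on `Kum_λ` are CYCLIC of order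
# `2^k` and CO-CYCLIC (`Kum_λ = line + ℤe₀`) — the hypothesis `hcyc` of the refill law at a pure-sign step

Width seat `bsd-line-krr2-p2` g13 (ONE READER on S1b); `--supports stmt-BirchSwinnertonDyer-28083` (helper). THEOREMS
ONLY; nothing here proves S1b, U1, a rung or BSD. BSD is NOT proved.

## What (the REGULAR analogue of this lineage's `SwapFrobeniusEigenLinesAtTwo` / `SwapKummerEigenLinesAtTwo`, g6)

At a DIAGONAL Kolyvagin prime (Gross's condition, Frobenius ∼ complex conjugation) the eigen-subgroups of
`Kum_λ ≅ E[2^k]` are `ℤ/2^k ⊕ ℤ/2` — the source of Mazur–Rubin's (H.2) failure at `2`. At a REGULAR Kolyvagin prime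
`ℓ` (the regularity datum of LINE 17 = body of the pen's `IsRegularPrimeAt W k ℓ`: an arithmetic Frobenius `h` at a
prime over `ℓ` with `h² = 1` on `E[2^k]` and `2^(k−1)(P + hP) ≠ 0` for some `P`) they are CYCLIC:
* §1 `frob_regular_of_regularDatum` — EVERY arithmetic Frobenius `Fr` at the place `(ℓ)` acts on `E[2^k](ℚ̄)` as a
  regular involution (it acts as a conjugate `g h g⁻¹`: transitivity on the primes above `ℓ`, `IsArithFrobAt.conj`,
  `mul_inv_mem_inertia`, and inertia fixes `E[2^k]` at the good odd prime `ℓ` — g6's `exists_conj_of_frobEqFrobInfty`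
  with Gross's condition replaced by regularity);
* §2 `frob_regular_eigenlines` — hence (gk2-p3's `GenusExact.RegularPlusDescent.free_of_regular` /
  `three_cyclicities_of_free`) `E[2^k] = ℤP ⊕ ℤ·FrP`, `ker(Fr − s) = ℤ(P + s·FrP)` of order `2^k` (`s = ±1`);
* §3 `torsionMap_regular_eigen` — transported to `E[2^k](K̄)` and the adapted lift `t_*` of `τ` (g6's brick D:
  `t_*` acts as a `ℚ`-Frobenius at `ℓ`);
* §4 `kummer_regular_eigen_at_two` — on `Kum_λ ≤ H¹(K_λ, E[2^k])` through the evaluation equivalence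
  `H¹_ur ≃+ E[2^k](K̄)` carrying `σ_*` to `t_*` (g6's `exists_addEquiv_unramified_eval`): for `s = ±1` the eigen-line
  `Kum_λ ∩ ker(σ_* − s)` is `ℤc_s` with `addOrderOf c_s = 2^k`, and `Kum_λ = ℤc_s' + ℤe₀`-co-cyclic:
  `∀ f ∈ Kum_λ, ∃ m, f − m•e₀ ∈ Kum_λ ∩ ker(σ_* − s)`. With `conjActPlace_localization` (tree: `loc_λ ∘ τ_* = σ_* ∘ loc_λ`)
  this discharges the co-cyclicity hypothesis `hcyc` of `RegularRefill.two_nsmul_mem_map_localization_relaxed_selmerF`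
  (p674377) at every pure-sign step of the walk: if `loc_λ(H¹_{𝓕(c/ℓ)})` contains a `τ`-eigenclass image of order `2^k`,
  it contains the whole eigen-line, and `Kum_λ` is that line `+ ℤe₀`.
References (locators only; no cited FACT is declared): [cite: MazurRubin2004, §2.4 (H.2), Lemma 1.2.4] [cite: GrossLMS1991,
§3 (3.1)–(3.4)] [cite: McCallumLMS1991, Lemma 5.3] [cite: Jetchev2008, §3.2 (2)] [cite: SilvermanAEC2009, Prop. VII.4.1].
Design: no definitions; `K : Type`; axioms `propext`, `Classical.choice`, `Quot.sound`.
-/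

set_option autoImplicit false
-- the Theorems namespace of this sub repeats the summit name by design (D-0017 nested layout)
set_option linter.dupNamespace false

noncomputable section

open scoped Classical Pointwise
open Function NumberField IsDedekindDomain WeierstrassCurve Field Rat.HeightOneSpectrum
open Literature.NumberTheory.EllipticCurves Literature.NumberTheory.GaloisRepresentations
open Literature.NumberTheory.GaloisRepresentations.IsNonarchimedeanLocalField
open Literature.NumberTheory.GaloisCohomology Literature.NumberTheory.Automorphic
open Literature.AnabelianGeometry.AbsoluteAnabelian
open _root_.TopRep _root_.ContinuousCohomology
open Summit.BirchSwinnertonDyer.Rank1Residual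
open Summit.BirchSwinnertonDyer.Rank1Residual.X11b.Three.Koly.Method2
open Summit.BirchSwinnertonDyer.Rank1Residual.JET.GlobalDuality
open Summit.BirchSwinnertonDyer.BirchSwinnertonDyer.Theorems.KolyvaginLowerBoundAtTwo
open Summit.BirchSwinnertonDyer.BirchSwinnertonDyer.Theorems.GenusExact.RegularPlusDescent

namespace Summit.BirchSwinnertonDyer.BirchSwinnertonDyer.Theorems.KolyvaginAtTwo.RegularRefill

variable (W : WeierstrassCurve ℚ) [W.IsElliptic] [W.IsGloballyMinimal]

/-! ### §1 Every Frobenius at a regular prime is a regular involution on `E[2^k]` -/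

omit [W.IsGloballyMinimal] in
/-- **At a regular prime, every arithmetic Frobenius is a regular involution on `E[2^k](ℚ̄)`.** If some arithmetic
Frobenius `h` at a prime over the good odd prime `ℓ` acts on `E[2^k]` as an involution with `2^(k−1)(P + hP) ≠ 0`
for some `P`, then so does EVERY arithmetic Frobenius `Fr` at the place `(ℓ)` (it acts as `g h g⁻¹`: the primes
above `ℓ` are conjugate, `IsArithFrobAt.conj`, two Frobenius elements at one prime differ by inertia, and inertia
fixes `E[2^k]` at a good prime `ℓ ∤ 2`). [cite: GrossLMS1991, §3 (3.2)–(3.3)] [cite: SilvermanAEC2009, Prop. VII.4.1 (a)] -/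
theorem frob_regular_of_regularDatum {ℓ k : ℕ} (hℓ : ℓ.Prime) (hℓ2 : ℓ ≠ 2)
    (hreg : ∃ (v₁ : HeightOneSpectrum (𝓞 ℚ)) (𝔓₁ : Ideal (absIntegers (𝓞 ℚ) ℚ)) (h : absoluteGaloisGroup ℚ),
      (ℓ : 𝓞 ℚ) ∈ v₁.asIdeal ∧ 𝔓₁ ∈ v₁.primesAbove ∧ IsArithFrobAt (𝓞 ℚ) h 𝔓₁ ∧
      (∀ X : geomTorsion W ((2 ^ k : ℕ) : ℤ), h • h • X = X) ∧
      ∃ P : geomTorsion W ((2 ^ k : ℕ) : ℤ), (2 : ℤ) ^ (k - 1) • (P + h • P) ≠ 0)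
    {v : HeightOneSpectrum (𝓞 ℚ)} (hℓv : (ℓ : 𝓞 ℚ) ∈ v.asIdeal) (hgood : W.HasGoodReductionAt v)
    {Fr : absoluteGaloisGroup ℚ} (hFr : IsArithFrobAtPlace ℚ v Fr) :
    (∀ X : geomTorsion W ((2 ^ k : ℕ) : ℤ), Fr • Fr • X = X) ∧
      ∃ P : geomTorsion W ((2 ^ k : ℕ) : ℤ), (2 : ℤ) ^ (k - 1) • (P + Fr • P) ≠ 0 := by
  obtain ⟨v₁, 𝔓₁, h, hℓv₁, h𝔓₁, hh, hinv, P₀, hP₀⟩ := hreg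
  -- `v₁ = v`: both contain `ℓ`
  have hv : v₁ = v := by
    apply primesEquiv.injective
    apply Subtype.ext
    rw [primesEquiv_eq_of_natCast_mem hℓ hℓv₁, primesEquiv_eq_of_natCast_mem hℓ hℓv]
  subst hv
  obtain ⟨𝔓, h𝔓, hFr𝔓⟩ := hFr
  obtain ⟨g, hg⟩ := HeightOneSpectrum.exists_smul_eq_of_mem_primesAbove_holds h𝔓₁ h𝔓
  have hh' : IsArithFrobAt (𝓞 ℚ) (g * h * g⁻¹) 𝔓 := by rw [← hg]; exact hh.conj g
  have hin : Fr * (g * h * g⁻¹)⁻¹ ∈ 𝔓.inertia (absoluteGaloisGroup ℚ) :=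
    hFr𝔓.mul_inv_mem_inertia hh'
  -- `2^k ∉ v` since `ℓ` is odd
  have h2v : ((((2 ^ k : ℕ) : ℤ)) : 𝓞 ℚ) ∉ v₁.asIdeal := by
    intro hmem
    have hmem' : ((2 : ℕ) : 𝓞 ℚ) ^ k ∈ v₁.asIdeal := by
      have : ((((2 ^ k : ℕ) : ℤ)) : 𝓞 ℚ) = ((2 : ℕ) : 𝓞 ℚ) ^ k := by push_cast; ring
      rwa [this] at hmem
    have h2 : ((2 : ℕ) : 𝓞 ℚ) ∈ v₁.asIdeal := v₁.isPrime.mem_of_pow_mem k hmem'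
    have e1 := primesEquiv_eq_of_natCast_mem Nat.prime_two h2
    have e2 := primesEquiv_eq_of_natCast_mem hℓ hℓv₁
    exact hℓ2 (e2.symm.trans e1)
  -- `Fr` acts as `g h g⁻¹`
  have hFrP : ∀ P : geomTorsion W ((2 ^ k : ℕ) : ℤ), Fr • P = g • h • g⁻¹ • P := fun P ↦ by
    have htriv : (Fr * (g * h * g⁻¹)⁻¹) • ((g * h * g⁻¹) • P) = (g * h * g⁻¹) • P :=
      W.smul_geomTorsion_eq_of_mem_inertia hgood h2v h𝔓 hin _
    rw [smul_smul, inv_mul_cancel_right] at htriv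
    rw [htriv, mul_smul, mul_smul]
  refine ⟨fun X ↦ ?_, ⟨g • P₀, fun h0 ↦ hP₀ ?_⟩⟩
  · rw [hFrP, hFrP X, smul_smul g⁻¹ g, inv_mul_cancel, one_smul, hinv, smul_smul, mul_inv_cancel, one_smul]
  · rw [hFrP, smul_smul g⁻¹ g, inv_mul_cancel, one_smul, ← smul_add, smul_comm, smul_eq_zero_iff_eq] at h0
    exact h0

/-! ### §2 Eigen-lines of a regular involution on `E[2^k](ℚ̄)` (gk2-p3's three cyclicities) -/

omit [W.IsGloballyMinimal] in
/-- **Eigen-lines of a regular involution.** For `Fr ∈ Γ_ℚ` acting on `E[2^k]` (`1 ≤ k`) as an involution with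
`2^(k−1)(P + Fr P) ≠ 0` for some `P`: there is `P` with `E[2^k] = ℤP ⊕ ℤ·FrP` (free), and for `s = ±1` the `s`-eigen
subgroup is `ℤ(P + s·FrP)`, of order `2^k`. (gk2-p3's `free_of_regular` + `three_cyclicities_of_free`.)
[cite: McCallumLMS1991, Lemma 5.3] [cite: GrossLMS1991, §3 (3.1)–(3.3)] -/
theorem frob_regular_eigenlines {k : ℕ} (hk : 1 ≤ k) {Fr : absoluteGaloisGroup ℚ}
    (hinv : ∀ X : geomTorsion W ((2 ^ k : ℕ) : ℤ), Fr • Fr • X = X)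
    (hreg : ∃ P : geomTorsion W ((2 ^ k : ℕ) : ℤ), (2 : ℤ) ^ (k - 1) • (P + Fr • P) ≠ 0) :
    ∃ P : geomTorsion W ((2 ^ k : ℕ) : ℤ),
      (∀ Q : geomTorsion W ((2 ^ k : ℕ) : ℤ), ∃ a b : ℤ, Q = a • P + b • (Fr • P)) ∧
      (∀ a b : ℤ, a • P + b • (Fr • P) = 0 → ((2 ^ k : ℕ) : ℤ) ∣ a ∧ ((2 ^ k : ℕ) : ℤ) ∣ b) ∧
      ∀ s : ℤ, s = 1 ∨ s = -1 →
        addOrderOf (P + s • (Fr • P)) = 2 ^ k ∧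
        ∀ Q : geomTorsion W ((2 ^ k : ℕ) : ℤ), Fr • Q = s • Q ↔ Q ∈ AddSubgroup.zmultiples (P + s • (Fr • P)) := by
  obtain ⟨n, rfl⟩ : ∃ n, k = n + 1 := ⟨k - 1, (Nat.sub_add_cancel hk).symm⟩
  obtain ⟨P, hP⟩ := hreg
  rw [Nat.add_sub_cancel] at hP
  obtain ⟨hfree, hgen⟩ := free_of_regular W n P hP
  obtain ⟨⟨h1o, h1⟩, ⟨h2o, h2⟩, -⟩ := three_cyclicities_of_free W (n + 1) P (hinv P) hgen hfree
  refine ⟨P, hgen, hfree, fun s hs ↦ ?_⟩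
  rcases hs with rfl | rfl
  · rw [one_smul]
    exact ⟨h1o, fun Q ↦ by rw [one_smul]; exact h1 Q⟩
  · rw [neg_one_zsmul, ← sub_eq_add_neg]
    exact ⟨h2o, fun Q ↦ by rw [neg_one_zsmul]; exact h2 Q⟩

/-! ### §3 On `E[2^k](K̄)` with the adapted lift `t_*` of `τ` (g6's brick D, regular version) -/

variable (K : Type) [Field K] [NumberField K]

/-- **Regular brick D.** `K` imaginary quadratic, `τ ≠ 1`, `ℓ` a Zhang–Kolyvagin prime at `2` with `1 ≤ k ≤ M(ℓ)` that is
REGULAR at level `2^k`, `w ∋ ℓ`, `𝔓 ∣ w`, and a lift `t` of `τ` whose transport `γ ∈ Γ_ℚ` stabilises `𝔓 ∩ \bar ℤ`: then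
`E[2^k](K̄) = ℤQ₀ ⊕ ℤ·t_*Q₀` for some `Q₀`, and for `s = ±1` the `s`-eigen-subgroup of `t_*` is `ℤ(Q₀ + s·t_*Q₀)`, of
order `2^k`. (`γ` acts on `E[2^k](ℚ̄)` as a `ℚ`-Frobenius `h'` at `𝔓 ∩ \bar ℤ` — g6's argument: `h'⁻¹γ` fixes `K` and
lies in `G_𝔓`, which fixes `E[2^k](K̄)` — and `h'` is a regular involution by §1.)
[cite: GrossLMS1991, §3 (3.1)–(3.4)] [cite: Jetchev2008, §3.2 (2) (p. 815)] -/
theorem torsionMap_regular_eigen (hK : IsImaginaryQuadratic K) {k ℓ : ℕ} (hk1 : 1 ≤ k)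
    (hℓ : Zhang2014.IsKolyvaginPrime (W.conductorNorm ℤ) W K 2 ℓ)
    (hk : k ≤ Zhang2014.kolyvaginIndex W 2 ℓ)
    (hreg : ∃ (v₁ : HeightOneSpectrum (𝓞 ℚ)) (𝔓₁ : Ideal (absIntegers (𝓞 ℚ) ℚ)) (h : absoluteGaloisGroup ℚ),
      (ℓ : 𝓞 ℚ) ∈ v₁.asIdeal ∧ 𝔓₁ ∈ v₁.primesAbove ∧ IsArithFrobAt (𝓞 ℚ) h 𝔓₁ ∧
      (∀ X : geomTorsion W ((2 ^ k : ℕ) : ℤ), h • h • X = X) ∧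
      ∃ P : geomTorsion W ((2 ^ k : ℕ) : ℤ), (2 : ℤ) ^ (k - 1) • (P + h • P) ≠ 0)
    (w : HeightOneSpectrum (𝓞 K)) (hw : (ℓ : 𝓞 K) ∈ w.asIdeal)
    {𝔓 : Ideal (absIntegers (𝓞 K) K)} (h𝔓 : 𝔓 ∈ w.primesAbove)
    {τ : K ≃ₐ[ℚ] K} (hτ1 : τ ≠ 1) {t : AlgebraicClosure K ≃+* AlgebraicClosure K} (ht : IsLiftOfAut τ t)
    {γ : absoluteGaloisGroup ℚ} (hγ : ∀ x, t x = absGaloisTransport (K := ℚ) (L := K) γ x)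
    (hγD : γ ∈ (𝔓.comap (absIntegersMap ℚ K)).decompositionSubgroup (absoluteGaloisGroup ℚ)) :
    ∃ Q₀ : geomTorsion (W.baseChange K) ((2 ^ k : ℕ) : ℤ),
      (∀ Q : geomTorsion (W.baseChange K) ((2 ^ k : ℕ) : ℤ), ∃ a b : ℤ,
        Q = a • Q₀ + b • ht.torsionMap W ((2 ^ k : ℕ) : ℤ) Q₀) ∧
      ∀ s : ℤ, s = 1 ∨ s = -1 →
        addOrderOf (Q₀ + s • ht.torsionMap W ((2 ^ k : ℕ) : ℤ) Q₀) = 2 ^ k ∧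
        ∀ Q : geomTorsion (W.baseChange K) ((2 ^ k : ℕ) : ℤ),
          ht.torsionMap W ((2 ^ k : ℕ) : ℤ) Q = s • Q ↔
            Q ∈ AddSubgroup.zmultiples (Q₀ + s • ht.torsionMap W ((2 ^ k : ℕ) : ℤ) Q₀) := by
  have hℓp : ℓ.Prime := hℓ.1
  have hℓ2 : ℓ ≠ 2 := hℓ.2.2.2.1
  have hℓP : (Ideal.span {(ℓ : 𝓞 K)}).IsPrime := hℓ.2.2.2.2.1
  set n : ℤ := ((2 ^ k : ℕ) : ℤ) with hn
  -- the place `v₁` of `ℚ` below `w`, the prime `𝔓'`, a Frobenius `h'` (verbatim g6)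
  set v₁ : HeightOneSpectrum (𝓞 ℚ) := w.under (𝓞 ℚ) with hv₁
  have hwv₁ : w.asIdeal.under (𝓞 ℚ) = v₁.asIdeal := rfl
  have hℓv₁ : (ℓ : 𝓞 ℚ) ∈ v₁.asIdeal := by
    rw [← hwv₁, Ideal.under_def, Ideal.mem_comap, map_natCast]; exact hw
  have hgood₁ : W.HasGoodReductionAt v₁ :=
    LocalFrob.hasGoodReductionAt_rat_of_not_dvd_conductorNorm W hℓp hℓ.2.1 v₁ hℓv₁
  set 𝔓' := 𝔓.comap (absIntegersMap ℚ K) with h𝔓'def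
  have h𝔓' : 𝔓' ∈ v₁.primesAbove := comap_absIntegersMap_mem_primesAbove hwv₁ h𝔓
  haveI : 𝔓'.IsPrime := h𝔓'.1
  obtain ⟨h', hh'⟩ := HeightOneSpectrum.exists_isArithFrobAt_of_mem_primesAbove_holds h𝔓'
  have hlift : IsLiftOfAut τ (absGaloisTransport (K := ℚ) (L := K) h').toRingEquiv :=
    isLiftOfAut_absGaloisTransport_of_isArithFrobAt K hK hτ1 hℓp hℓP hw h𝔓 hℓv₁ h𝔓' hh'
  set g₀ : absoluteGaloisGroup ℚ := h'⁻¹ * γ with hg₀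
  have hg₀K : g₀ ∈ Set.range (absGaloisRestrict ℚ K) := by
    rw [mem_range_absGaloisRestrict_iff]
    intro x
    rw [hg₀, map_mul, map_inv, AlgEquiv.mul_apply, ← hγ, ht x]
    have hx : absGaloisTransport (K := ℚ) (L := K) h' (algebraMap K (AlgebraicClosure K) x) =
        algebraMap K (AlgebraicClosure K) (τ x) := hlift x
    rw [← hx, ← AlgEquiv.mul_apply, inv_mul_cancel, AlgEquiv.one_apply]
  obtain ⟨g₁, hg₁⟩ := hg₀K
  have hg₁D : g₁ ∈ 𝔓.decompositionSubgroup (absoluteGaloisGroup K) := by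
    rw [← comap_decompositionSubgroup_comap_absIntegersMap ℚ K 𝔓, Subgroup.mem_comap]
    change absGaloisRestrict ℚ K g₁ ∈ 𝔓'.decompositionSubgroup (absoluteGaloisGroup ℚ)
    rw [hg₁, hg₀]
    exact Subgroup.mul_mem _ (Subgroup.inv_mem _ hh'.mem_stabilizer) hγD
  have hg₀P : ∀ P : geomTorsion W n, g₀ • P = P := fun P => by
    apply (RatClosure.torsionEquiv (K := K) W n).injective
    rw [← hg₁, RatClosure.torsionEquiv_smul,
      smul_torsion_eq_self_of_mem_decompositionSubgroup W K hK hℓ hk w hw h𝔓 hg₁D]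
  have hγP : ∀ P : geomTorsion W n, γ • P = h' • P := fun P => by
    have e : γ = h' * g₀ := by rw [hg₀, mul_inv_cancel_left]
    rw [e, mul_smul, hg₀P]
  have hFr : IsArithFrobAtPlace ℚ v₁ h' := ⟨𝔓', h𝔓', hh'⟩
  -- `h'` is a regular involution (§1), with eigen-lines (§2)
  obtain ⟨hinv', hreg'⟩ := frob_regular_of_regularDatum W hℓp hℓ2 hreg hℓv₁ hgood₁ hFr
  obtain ⟨P, hgen, -, heig⟩ := frob_regular_eigenlines W hk1 hinv' hreg'
  -- transport along `E[2^k](ℚ̄) ≃ E[2^k](K̄)`, which carries `γ` (= `h'`) to `t_*`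
  set eK := RatClosure.torsionEquiv (K := K) W n with heK
  have ht' : ∀ X : geomTorsion W n, eK (h' • X) = ht.torsionMap W n (eK X) := fun X ↦ by
    rw [← hγP, heK, RatClosure.torsionEquiv_smul_of_lift W ht γ hγ n X]
  refine ⟨eK P, fun Q ↦ ?_, fun s hs ↦ ?_⟩
  · obtain ⟨a, b, hab⟩ := hgen (eK.symm Q)
    refine ⟨a, b, ?_⟩
    rw [← ht', ← map_zsmul, ← map_zsmul, ← map_add, ← hab, AddEquiv.apply_symm_apply]
  · obtain ⟨hord, hmem⟩ := heig s hs
    have hx : eK (P + s • (h' • P)) = eK P + s • ht.torsionMap W n (eK P) := by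
      rw [map_add, map_zsmul, ht']
    refine ⟨?_, fun Q ↦ ?_⟩
    · rw [← hx, AddEquiv.addOrderOf_eq, hord]
    · have hQ : ht.torsionMap W n Q = s • Q ↔ h' • eK.symm Q = s • eK.symm Q := by
        conv_lhs => rw [← eK.apply_symm_apply Q]
        rw [← ht', ← map_zsmul, eK.apply_eq_iff_eq]
      rw [hQ, hmem (eK.symm Q), ← hx, AddSubgroup.mem_zmultiples_iff, AddSubgroup.mem_zmultiples_iff]
      constructor
      · rintro ⟨m, hm⟩
        exact ⟨m, by rw [← map_zsmul, hm, AddEquiv.apply_symm_apply]⟩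
      · rintro ⟨m, hm⟩
        exact ⟨m, eK.injective (by rw [map_zsmul, hm, AddEquiv.apply_symm_apply])⟩

/-! ### §4 On the local Kummer group `Kum_λ` (g6's brick E, regular version): cyclic and co-cyclic eigen-lines -/

-- the evaluation-equivalence transport elaborates slowly (as in this lineage's `kummer_eigen_at_two`)
set_option maxHeartbeats 800000 in
/-- **REGULAR EIGEN-LINES ON `Kum_λ`.** `K` imaginary quadratic, `τ ≠ 1`, `ℓ` a Zhang–Kolyvagin prime at `2` with
`1 ≤ k ≤ M(ℓ)`, REGULAR at level `2^k` (LINE 17's `IsRegularPrimeAt W k ℓ`, body inlined), `v ∋ ℓ` with `τ • v = v`,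
`s = ±1`. Then: (a) the `s`-eigen-subgroup `Kum_v ∩ ker(σ_* − s)` of `σ_* = conjActPlace W τ 2^k hfix` is CYCLIC,
`= ℤc_s` with `addOrderOf c_s = 2^k`; (b) it is CO-CYCLIC in `Kum_v`: for some `e₀ ∈ Kum_v`, every `f ∈ Kum_v` has
`f − m•e₀ ∈ Kum_v ∩ ker(σ_* − s)` for some `m`. (`Kum_v = H¹_ur ≃+ E[2^k](K̄)` carrying `σ_*` to `t_*`, §3.) In the walk
of S1b, (b) is the hypothesis `hcyc` of the refill law `RegularRefill.two_nsmul_mem_map_localization_relaxed_selmerF`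
(p674377) at a pure-sign step, and (a) says a `τ`-eigenclass whose image at `v` has order `2^k` generates the whole
eigen-line. [cite: MazurRubin2004, §2.4 (H.2), Lemma 1.2.4] [cite: Jetchev2008, §3.2 (2), Prop. 4.2]
[cite: GrossLMS1991, §3 (3.1)–(3.4)] -/
theorem kummer_regular_eigen_at_two (hK : IsImaginaryQuadratic K) {k ℓ : ℕ} (hk1 : 1 ≤ k)
    (hℓ : Zhang2014.IsKolyvaginPrime (W.conductorNorm ℤ) W K 2 ℓ)
    (hk : k ≤ Zhang2014.kolyvaginIndex W 2 ℓ)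
    (hreg : ∃ (v₁ : HeightOneSpectrum (𝓞 ℚ)) (𝔓₁ : Ideal (absIntegers (𝓞 ℚ) ℚ)) (h : absoluteGaloisGroup ℚ),
      (ℓ : 𝓞 ℚ) ∈ v₁.asIdeal ∧ 𝔓₁ ∈ v₁.primesAbove ∧ IsArithFrobAt (𝓞 ℚ) h 𝔓₁ ∧
      (∀ X : geomTorsion W ((2 ^ k : ℕ) : ℤ), h • h • X = X) ∧
      ∃ P : geomTorsion W ((2 ^ k : ℕ) : ℤ), (2 : ℤ) ^ (k - 1) • (P + h • P) ≠ 0)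
    (v : HeightOneSpectrum (𝓞 K)) (hv : (ℓ : 𝓞 K) ∈ v.asIdeal)
    {τ : K ≃ₐ[ℚ] K} (hτ1 : τ ≠ 1) (hfix : τ • v = v) {s : ℤ} (hs : s = 1 ∨ s = -1) :
    (∃ c : galoisCohomology
          (((W.baseChange K).torsionGaloisModule ((2 ^ k : ℕ) : ℤ)).toLocal (Sum.inr v : Place K)) 1,
        c ∈ (W.baseChange K).kummerSelmerStructure ((2 ^ k : ℕ) : ℤ) (Sum.inr v) ∧ addOrderOf c = 2 ^ k ∧
        ∀ c' : galoisCohomology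
            (((W.baseChange K).torsionGaloisModule ((2 ^ k : ℕ) : ℤ)).toLocal (Sum.inr v : Place K)) 1,
          c' ∈ (W.baseChange K).kummerSelmerStructure ((2 ^ k : ℕ) : ℤ) (Sum.inr v) ⊓
              (conjActPlace W τ ((2 ^ k : ℕ) : ℤ) hfix - s • AddMonoidHom.id _).ker ↔
            c' ∈ AddSubgroup.zmultiples c) ∧
    ∃ e₀ : galoisCohomology
          (((W.baseChange K).torsionGaloisModule ((2 ^ k : ℕ) : ℤ)).toLocal (Sum.inr v : Place K)) 1,
      e₀ ∈ (W.baseChange K).kummerSelmerStructure ((2 ^ k : ℕ) : ℤ) (Sum.inr v) ∧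
      ∀ f ∈ (W.baseChange K).kummerSelmerStructure ((2 ^ k : ℕ) : ℤ) (Sum.inr v), ∃ m : ℤ,
        f - m • e₀ ∈ (W.baseChange K).kummerSelmerStructure ((2 ^ k : ℕ) : ℤ) (Sum.inr v) ⊓
          (conjActPlace W τ ((2 ^ k : ℕ) : ℤ) hfix - s • AddMonoidHom.id _).ker := by
  haveI : Fact (Nat.Prime 2) := ⟨Nat.prime_two⟩
  have hss : s * s = 1 := by rcases hs with rfl | rfl <;> norm_num
  set n : ℤ := ((2 ^ k : ℕ) : ℤ) with hn
  obtain ⟨hgood, hpv⟩ := hasGoodReductionAt_of_zhangKolyvaginPrime W K hℓ v hv 1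
  have hpv' : ((2 : ℕ) : 𝓞 K) ∉ v.asIdeal := by rwa [pow_one, Int.cast_natCast] at hpv
  have hKum := X11b.KummerPT.kummerSelmerStructure_inr_eq_unramifiedSubgroup (W.baseChange K) 2 k hpv'
    hgood
  obtain ⟨γ, hγ, hγD⟩ := exists_transport_liftAutPlace_mem_decompositionSubgroup K τ hfix
  set hτ := isLiftOfAut_liftAutPlace τ hfix with hτdef
  obtain ⟨Q₀, hgenQ, heigQ⟩ := torsionMap_regular_eigen W K hK hk1 hℓ hk hreg v hv
    (adicCompletionPrime_mem_primesAbove K v) hτ1 hτ hγ hγD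
  obtain ⟨hordQ, hmemQ⟩ := heigQ s hs
  -- the evaluation equivalence `e : H¹_ur ≃+ E[2^k](K̄)` carrying `σ_*` to `t_*`
  set L := v.adicCompletion K with hL
  set ρ := GaloisRep.toLocal v ((W.baseChange K).torsionGaloisModule n) with hρ
  haveI : Finite (geomTorsion (W.baseChange K) n) :=
    finite_torsionPoints_holds (W.baseChange K) (AlgebraicClosure K) (by rw [hn]; positivity)
  obtain ⟨φ, hφ⟩ := exists_isAbsArithFrob_holds L
  have hφ1 : IsFrobPow φ 1 := IsAbsArithFrob.isFrobPow_holds hφ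
  set hΘ := isLiftOfRingEquiv_ringEquivLift (galAdicCompletionEquiv (L := K) τ hfix) with hΘdef
  set hc := liftsCommute_liftAutPlace τ hfix with hcdef
  set T : galoisCohomology ρ 1 →+ galoisCohomology ρ 1 := conjActPlace W τ n hfix with hTdef
  set tt : geomTorsion (W.baseChange K) n →+ geomTorsion (W.baseChange K) n := hτ.torsionMap W n with httdef
  set U := DiscreteGaloisModule.unramifiedSubgroup ρ 1 with hU
  obtain ⟨e, hTU, he⟩ := exists_addEquiv_unramified_eval ρ
    (galoisRep_toLocal_apply_eq_self W K hK hℓ hk v hv) hφ1 T tt (fun g => hΘ.conjGalCMH g)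
    (fun ψ ↦ ⟨contOneCocycles.pullback hΘ.conjGalCMH (localConjHom W hτ hΘ hc n) ψ,
      localConjH1_oneCocycleClass W hτ hΘ hc n ψ, fun g ↦ by rw [contOneCocycles.pullback_apply]; rfl⟩)
    (isFrobPow_conjGalCMH K τ hfix hΘ hφ1)
    (fun i hi ↦ by
      rw [← isFrobPow_zero_iff_mem_absInertia] at hi ⊢
      exact isFrobPow_conjGalCMH K τ hfix hΘ hi)
  -- `Kum_v = H¹_ur`
  have hKum' : (W.baseChange K).kummerSelmerStructure n (Sum.inr v) = U := by rw [hKum]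
  have hTe : ∀ u : U, (e ⟨T u.1, hTU u.1 u.2⟩ : geomTorsion (W.baseChange K) n) = tt (e u) :=
    fun u ↦ he u (hTU u.1 u.2)
  -- eigen ⇔ image eigen
  have heig_iff : ∀ u : U, T u.1 = s • u.1 ↔ tt (e u) = s • e u := fun u ↦ by
    rw [← hTe, ← map_zsmul, e.apply_eq_iff_eq]
    constructor
    · intro h1; exact Subtype.ext (by rw [AddSubgroupClass.coe_zsmul]; exact h1)
    · intro h1; have := congrArg Subtype.val h1; rwa [AddSubgroupClass.coe_zsmul] at this
  set x : geomTorsion (W.baseChange K) n := Q₀ + s • tt Q₀ with hx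
  set c : U := e.symm x with hcdef'
  have hec : e c = x := e.apply_symm_apply x
  have hTc : T c.1 = s • c.1 :=
    (heig_iff c).mpr (by rw [hec]; exact (hmemQ x).mpr (AddSubgroup.mem_zmultiples x))
  -- membership in the eigen-line, read through `e`
  have hline : ∀ c' : galoisCohomology ρ 1,
      c' ∈ (W.baseChange K).kummerSelmerStructure n (Sum.inr v) ⊓ (T - s • AddMonoidHom.id _).ker ↔
        c' ∈ AddSubgroup.zmultiples (c : galoisCohomology ρ 1) := by
    intro c'
    constructor
    · intro h
      obtain ⟨hc'K, hTc'⟩ := AddSubgroup.mem_inf.mp h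
      have hc'U : c' ∈ U := by rw [← hKum']; exact hc'K
      have hTc'' : T c' = s • c' := by
        have h0 := (AddMonoidHom.mem_ker).mp hTc'
        rw [AddMonoidHom.sub_apply, AddMonoidHom.smul_apply, AddMonoidHom.id_apply, sub_eq_zero] at h0
        exact h0
      have h1 : tt (e ⟨c', hc'U⟩) = s • e ⟨c', hc'U⟩ := (heig_iff ⟨c', hc'U⟩).mp hTc''
      obtain ⟨m, hm⟩ := AddSubgroup.mem_zmultiples_iff.mp ((hmemQ _).mp h1)
      refine AddSubgroup.mem_zmultiples_iff.mpr ⟨m, ?_⟩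
      have h2 : m • c = ⟨c', hc'U⟩ := e.injective (by rw [map_zsmul, hec, hm])
      have h3 := congrArg Subtype.val h2
      rwa [AddSubgroupClass.coe_zsmul] at h3
    · intro h
      obtain ⟨m, rfl⟩ := AddSubgroup.mem_zmultiples_iff.mp h
      refine AddSubgroup.mem_inf.mpr ⟨?_, ?_⟩
      · rw [hKum']; exact U.zsmul_mem c.2 m
      · refine (AddMonoidHom.mem_ker).mpr ?_
        rw [AddMonoidHom.sub_apply, AddMonoidHom.smul_apply, AddMonoidHom.id_apply, sub_eq_zero, map_zsmul, hTc,
          smul_comm]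
  refine ⟨⟨c.1, by rw [hKum']; exact c.2, ?_, hline⟩, ⟨(e.symm Q₀).1, by rw [hKum']; exact (e.symm Q₀).2, ?_⟩⟩
  · -- order
    change addOrderOf (U.subtype c) = 2 ^ k
    rw [addOrderOf_injective U.subtype U.subtype_injective, ← AddEquiv.addOrderOf_eq e, hec, hordQ]
  · -- co-cyclicity
    intro f hf
    have hfU : f ∈ U := by rw [← hKum']; exact hf
    obtain ⟨a, b, hab⟩ := hgenQ (e ⟨f, hfU⟩)
    refine ⟨a - s * b, (hline _).mpr (AddSubgroup.mem_zmultiples_iff.mpr ⟨s * b, ?_⟩)⟩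
    have hy : e ⟨f, hfU⟩ = a • Q₀ + b • tt Q₀ := hab
    have key : (s * b) • x = (a • Q₀ + b • tt Q₀) - (a - s * b) • Q₀ := by
      rw [hx]
      rcases hs with rfl | rfl
      · module
      · module
    have hL : e ((s * b) • c) = (s * b) • x := by rw [map_zsmul, hec]
    have hQ : e (e.symm Q₀) = Q₀ := e.apply_symm_apply Q₀
    have hR : e (⟨f, hfU⟩ - (a - s * b) • e.symm Q₀) = (a • Q₀ + b • tt Q₀) - (a - s * b) • Q₀ := by
      rw [map_sub, map_zsmul, hQ, hy]
    have h1 : e ((s * b) • c) = e (⟨f, hfU⟩ - (a - s * b) • e.symm Q₀) := by rw [hL, hR, key]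
    have h2 : (s * b) • c = ⟨f, hfU⟩ - (a - s * b) • e.symm Q₀ := e.injective h1
    have h3 := congrArg Subtype.val h2
    simp only [AddSubgroupClass.coe_zsmul, AddSubgroupClass.coe_sub] at h3
    exact h3

end Summit.BirchSwinnertonDyer.BirchSwinnertonDyer.Theorems.KolyvaginAtTwo.RegularRefill

end
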